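import Summits.Ventures.PackingBounds.ThreePointCert.C5TCert

/-!
# A(5, arccos 1/3) ≤ 23 (three-point bound, kernel-checked): kernel validation of Gram block R0 (chunks 1–6 of 16)

Framing: lottery ticket; floor = certified bounds/negative ranges. Venture `PackingBounds` (cell
`pub-packcert`), three-point SDP family. Integer data of a feasible point of the Bachoc–Vallentin
semidefinite program (n = 5, s = 1/3, degree d = 8, symmetric
sums of squares), derived by `pub-packcert-sdp/code/cert2lean.py` from the exact rational
certificate `sdp-n5-d8-s1-3-sym.json` of the cell (two independent exact verifiers + referee), in the
units of the kernel checker `ThreePointCert.Check` (soundness `ThreePointCert.Sound`). Generated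
file: plain lists of integers / monomials.
-/

namespace Summit.Ventures.PackingBounds.ThreePointCert.C5T

open Literature.Geometry.DiscreteGeometry Literature.Geometry.DiscreteGeometry.PolyCert PolyCert.SPoly

set_option maxHeartbeats 0 in
/-- Block `R0`: rows from 0 (35 rows) of `zᵀ(LLᵀ)z` added to `[]` give `dR0c1` (kernel). -/
theorem okR0_1 : chunkOK C5T.gR0 0 35 [] C5T.dR0c1 = true := by
  decide +kernel

set_option maxHeartbeats 0 in
/-- Block `R0`: rows from 35 (16 rows) of `zᵀ(LLᵀ)z` added to `dR0c1` give `dR0c2` (kernel). -/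
theorem okR0_2 : chunkOK C5T.gR0 35 16 C5T.dR0c1 C5T.dR0c2 = true := by
  decide +kernel

set_option maxHeartbeats 0 in
/-- Block `R0`: rows from 51 (12 rows) of `zᵀ(LLᵀ)z` added to `dR0c2` give `dR0c3` (kernel). -/
theorem okR0_3 : chunkOK C5T.gR0 51 12 C5T.dR0c2 C5T.dR0c3 = true := by
  decide +kernel

set_option maxHeartbeats 0 in
/-- Block `R0`: rows from 63 (11 rows) of `zᵀ(LLᵀ)z` added to `dR0c3` give `dR0c4` (kernel). -/
theorem okR0_4 : chunkOK C5T.gR0 63 11 C5T.dR0c3 C5T.dR0c4 = true := by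
  decide +kernel

set_option maxHeartbeats 0 in
/-- Block `R0`: rows from 74 (10 rows) of `zᵀ(LLᵀ)z` added to `dR0c4` give `dR0c5` (kernel). -/
theorem okR0_5 : chunkOK C5T.gR0 74 10 C5T.dR0c4 C5T.dR0c5 = true := by
  decide +kernel

set_option maxHeartbeats 0 in
/-- Block `R0`: rows from 84 (9 rows) of `zᵀ(LLᵀ)z` added to `dR0c5` give `dR0c6` (kernel). -/
theorem okR0_6 : chunkOK C5T.gR0 84 9 C5T.dR0c5 C5T.dR0c6 = true := by
  decide +kernel

end Summit.Ventures.PackingBounds.ThreePointCert.C5T
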